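import Summits.QuantumFields.YangMills.Theorems.BalabanLadderIRStubShellRung
import HarnessLib

/-!
# Frame cells and the tempered hypotheses (BalabanLadder IR line L2″, engine part 2a/2)

Helper module for item `stmt-QuantumFields-19354` (crux `IR` of route `BalabanLadder`; registered line L2″
«cell-tempered», skeleton of record `IR_birth_cell_v7.lean`; engine stub `Cruxes.IR.CellTempered.stub_temperedToTV`).
Route owner ym-beyond-p2 (g17), filed by the cell's courier.  Pure combinatorics / bookkeeping, no analysis:

* §A `frameIdx`, `frameCell` — the cell-index map of a GENERAL mesh-`b` frame `w : Fin 4 → ℤ → ℤ` (cell `y` =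
  the edge box `cellEdges w y`; item 8895's own proof only ever runs its recursion on the uniform grid, but its
  finite-size hypothesis — hence the target `TVCondAt` of the engine — quantifies over all frames): `frameCell_eq_iff`
  (`frameCell w v = y ↔ v ∈ cellEdges w y`), the recursion's hypotheses `frame_hC1` (edges at sup-distance `≤ 1`
  lie in cells at index distance `≤ 1`) and `finite_frameCell`, unions of cells (`regionEdges_union`), and the
  SHIFTED frames `shiftFrame w x` (cell `c` ↦ cell `c + x` of `w`; `shiftFrame_mesh`, `cellEdges_shiftFrame`).
* §B `hBad_of_rare`, `hFS_of_mix` — the two hypotheses of the tempered block recursion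
  (`Theorems.BalabanLadderIRTemperedRecursionStep` / `…TemperedRecursion`: per-cell rarity `hBad`, tempered
  finite-size condition `hFS`) at the cell map `frameCell w`, from per-frame data «good events `GoodW x c` of the
  shifted frames with sub-region mixing for pairs equal-or-both-good and per-cell rarity» — i.e. from the clauses of
  the skeleton's `CellTemperedCond` at the frames `shiftFrame w x` (the analogue of
  `Theorems.FiniteSizeCriterion.gridFS_of_frameFS`).

Part 2b/2 (`Theorems.BalabanLadderIRTemperedToTV`) chooses the constants and reads off 8895's hypothesis.

## Filing note (courier g7, 2026-08-26)

Filed from the route owner's `HOME/p2-g17-files/IRFrameCells.lean` (sha16 `e116302e5665d752`, 306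
lines, farm rc 0 / 0 sorry).  Courier delta = this paragraph + thirteen one-line docstrings on the §A
lemmas (the gate's `lint.docstring` demands `/-- -/` on every theorem) + the modifier `private` on
`frame_mono` (a `dedup.landed` false positive against an unrelated `Monotone f` lemma; the lemma is used
only in this file); every other declaration, statement and proof is byte-identical to the source.  No
mathematics added, no statement changed.
-/

set_option autoImplicit false

noncomputable section

open MeasureTheory
open Literature.Probability.LatticeModels
open Literature.MathematicalPhysics.QuantumLattice

/-! ## Part 2/2, §A — frame cells: the cell-index map of a general frame -/

namespace Summit.QuantumFields.YangMills.Cruxes.IR.CellTempered.Engine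

open Summit.QuantumFields.YangMills.Cruxes.IR.Tempered (cellEdges windowCells regionEdges)
open Summit.QuantumFields.YangMills.Cruxes.IR.ShellTempered (windowCellsPlus)

section FrameIdx

/-- The index of `t` in the increasing sequence `f`: the largest `j` with `f j ≤ t`. -/
def frameIdx (f : ℤ → ℤ) (t : ℤ) : ℤ := sSup {j : ℤ | f j ≤ t}

variable {f : ℤ → ℤ} (hf : ∀ j, f j + 1 ≤ f (j + 1))
include hf

/-- A frame sequence with `f j + 1 ≤ f (j + 1)` is monotone.  (`private`: courier delta — as a
public decl the gate's `dedup.landed` matcher identifies its printed statement `Monotone f` with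
`Literature.IUT.HodgeArakelov.NNRealAddHom.monotone`; used only inside this file.) -/
private theorem frame_mono : Monotone f := monotone_int_of_le_succ fun j => by linarith [hf j]

/-- `f j + m ≤ f (j + m)`: the frame gains at least `1` per step. -/
theorem frame_add_nat_le (j : ℤ) (m : ℕ) : f j + m ≤ f (j + m) := by
  induction m with
  | zero => simp
  | succ m ih =>
    have h1 := hf (j + m)
    push_cast
    rw [← add_assoc, ← add_assoc]
    linarith

/-- The index set `{j | f j ≤ t}` is non-empty. -/
theorem frameIdx_set_nonempty (t : ℤ) : ({j : ℤ | f j ≤ t} : Set ℤ).Nonempty := by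
  refine ⟨-((f 0 - t).toNat : ℤ), ?_⟩
  have h := frame_add_nat_le hf (-((f 0 - t).toNat : ℤ)) (f 0 - t).toNat
  rw [neg_add_cancel] at h
  have h2 : f 0 - t ≤ ((f 0 - t).toNat : ℤ) := Int.self_le_toNat _
  show f (-((f 0 - t).toNat : ℤ)) ≤ t
  linarith

/-- The index set `{j | f j ≤ t}` is bounded above. -/
theorem frameIdx_set_bddAbove (t : ℤ) : BddAbove ({j : ℤ | f j ≤ t} : Set ℤ) := by
  refine ⟨((t - f 0).toNat : ℤ), fun j hj => ?_⟩
  have hj : f j ≤ t := hj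
  by_cases hj0 : j ≤ 0
  · exact hj0.trans (by positivity)
  · push Not at hj0
    have h := frame_add_nat_le hf 0 j.toNat
    rw [Int.toNat_of_nonneg hj0.le, zero_add] at h
    have h2 : t - f 0 ≤ ((t - f 0).toNat : ℤ) := Int.self_le_toNat _
    linarith

/-- `f (frameIdx f t) ≤ t`. -/
theorem frameIdx_le (t : ℤ) : f (frameIdx f t) ≤ t :=
  Int.csSup_mem (frameIdx_set_nonempty hf t) (frameIdx_set_bddAbove hf t)

/-- `t < f (frameIdx f t + 1)`. -/
theorem lt_frameIdx_succ (t : ℤ) : t < f (frameIdx f t + 1) := by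
  by_contra h
  push Not at h
  have h1 : frameIdx f t + 1 ≤ frameIdx f t := le_csSup (frameIdx_set_bddAbove hf t) h
  linarith

/-- `frameIdx f t = j ↔ f j ≤ t < f (j + 1)`. -/
theorem frameIdx_eq_iff (t j : ℤ) : frameIdx f t = j ↔ f j ≤ t ∧ t < f (j + 1) := by
  constructor
  · rintro rfl
    exact ⟨frameIdx_le hf t, lt_frameIdx_succ hf t⟩
  · rintro ⟨h1, h2⟩
    refine le_antisymm ?_ (le_csSup (frameIdx_set_bddAbove hf t) h1)
    by_contra hlt
    push Not at hlt
    have h3 : f (j + 1) ≤ f (frameIdx f t) := frame_mono hf (by omega)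
    linarith [frameIdx_le hf t]

end FrameIdx

section Frames

variable {w : Fin 4 → ℤ → ℤ} (hw : ∀ i j, w i j + 1 ≤ w i (j + 1))

/-- The cell-index map of the frame `w`: the edge `v` lies in the cell `frameCell w v`. -/
def frameCell (w : Fin 4 → ℤ → ℤ) (v : ZdEdge 4) : Fin 4 → ℤ := fun i => frameIdx (w i) (v.1 i)

include hw in
/-- `frameCell w v = y ↔ v ∈ cellEdges w y`. -/
theorem frameCell_eq_iff (v : ZdEdge 4) (y : Fin 4 → ℤ) : frameCell w v = y ↔ v ∈ cellEdges w y := by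
  simp only [funext_iff, frameCell, frameIdx_eq_iff (hw _),
    Summit.QuantumFields.YangMills.Cruxes.IR.Tempered.cellEdges, Finset.mem_product,
    Finset.mem_univ, and_true, Fintype.mem_piFinset, Finset.mem_Ico]

include hw in
/-- Every edge lies in the edge box of its own frame cell. -/
theorem mem_cellEdges_frameCell (v : ZdEdge 4) : v ∈ cellEdges w (frameCell w v) :=
  (frameCell_eq_iff hw v _).1 rfl

include hw in
/-- Hypothesis `hC1` of the block recursion for frame cells: edges at sup-distance `≤ 1` lie in
cells at index distance `≤ 1` (cells have width `≥ 1`). -/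
theorem frame_hC1 (e e' : ZdEdge 4) (h : ∀ k, e'.1 k - 1 ≤ e.1 k ∧ e.1 k ≤ e'.1 k + 1)
    (k : Fin 4) : |frameCell w e k - frameCell w e' k| ≤ 1 := by
  have ha := frameIdx_le (hw k) (e.1 k)
  have ha' := lt_frameIdx_succ (hw k) (e.1 k)
  have hb := frameIdx_le (hw k) (e'.1 k)
  have hb' := lt_frameIdx_succ (hw k) (e'.1 k)
  have hk := h k
  simp only [frameCell]
  rw [abs_le]
  constructor
  · by_contra hlt
    push Not at hlt
    -- `a ≤ a' - 2`: then `w k (a + 1) ≤ w k (a' - 1)` and `w k (a' - 1) + 1 ≤ w k a'`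
    have h1 : w k (frameIdx (w k) (e.1 k) + 1) ≤ w k (frameIdx (w k) (e'.1 k) - 1) :=
      frame_mono (hw k) (by omega)
    have h2 := hw k (frameIdx (w k) (e'.1 k) - 1)
    rw [sub_add_cancel] at h2
    linarith [hk.1]
  · by_contra hlt
    push Not at hlt
    have h1 : w k (frameIdx (w k) (e'.1 k) + 1) ≤ w k (frameIdx (w k) (e.1 k) - 1) :=
      frame_mono (hw k) (by omega)
    have h2 := hw k (frameIdx (w k) (e.1 k) - 1)
    rw [sub_add_cancel] at h2
    linarith [hk.2]

include hw in
/-- Hypothesis `hfin` of the block recursion for frame cells: every cell has finitely many edges. -/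
theorem finite_frameCell (y : Fin 4 → ℤ) : Set.Finite {v : ZdEdge 4 | frameCell w v = y} :=
  (cellEdges w y).finite_toSet.subset fun v hv => Finset.mem_coe.2 ((frameCell_eq_iff hw v y).1 hv)

include hw in
/-- A union of cells is closed under «same cell». -/
theorem regionEdges_union (Y : Finset (Fin 4 → ℤ)) (v v' : ZdEdge 4)
    (h : frameCell w v = frameCell w v') (hv : v ∈ regionEdges w Y) : v' ∈ regionEdges w Y := by
  simp only [Summit.QuantumFields.YangMills.Cruxes.IR.Tempered.regionEdges, Finset.mem_biUnion] at hv ⊢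
  obtain ⟨y, hy, hvy⟩ := hv
  refine ⟨y, hy, ?_⟩
  rw [← frameCell_eq_iff hw] at hvy ⊢
  rw [← h, hvy]

/-- The frame shifted by the cell index `x`: its cell `c` is the cell `c + x` of `w`. -/
def shiftFrame (w : Fin 4 → ℤ → ℤ) (x : Fin 4 → ℤ) : Fin 4 → ℤ → ℤ := fun i j => w i (j + x i)

/-- A shifted frame keeps the mesh bounds `b ≤ w i (j + 1) - w i j ≤ 2 b`. -/
theorem shiftFrame_mesh {b : ℕ}
    (hwb : ∀ i j, w i j + ((b : ℕ) : ℤ) ≤ w i (j + 1) ∧ w i (j + 1) ≤ w i j + 2 * ((b : ℕ) : ℤ))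
    (x : Fin 4 → ℤ) :
    ∀ i j, shiftFrame w x i j + ((b : ℕ) : ℤ) ≤ shiftFrame w x i (j + 1) ∧
      shiftFrame w x i (j + 1) ≤ shiftFrame w x i j + 2 * ((b : ℕ) : ℤ) := by
  intro i j
  have h := hwb i (j + x i)
  simp only [shiftFrame]
  rw [add_right_comm j 1 (x i)]
  exact h

/-- The cell `c` of the shifted frame `shiftFrame w x` is the cell `c + x` of `w`. -/
theorem cellEdges_shiftFrame (x c : Fin 4 → ℤ) :
    cellEdges (shiftFrame w x) c = cellEdges w (c + x) := by
  simp only [Summit.QuantumFields.YangMills.Cruxes.IR.Tempered.cellEdges, shiftFrame, Pi.add_apply,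
    add_right_comm (c _) 1 (x _)]

/-- The region of `Y` in the shifted frame is the union of the cells `y + x` of `w`. -/
theorem regionEdges_shiftFrame (x : Fin 4 → ℤ) (Y : Finset (Fin 4 → ℤ)) :
    regionEdges (shiftFrame w x) Y = Y.biUnion fun y => cellEdges w (y + x) := by
  simp only [Summit.QuantumFields.YangMills.Cruxes.IR.Tempered.regionEdges]
  congr 1
  funext y
  exact cellEdges_shiftFrame x y

end Frames

end Summit.QuantumFields.YangMills.Cruxes.IR.CellTempered.Engine

/-! ## Part 2/2, §B — the tempered hypotheses of the recursion from the cell-tempered data -/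

namespace Summit.QuantumFields.YangMills.Cruxes.IR.CellTempered.Engine

open Summit.QuantumFields.YangMills.Cruxes.IR.Tempered (cellEdges windowCells regionEdges)
open Summit.QuantumFields.YangMills.Cruxes.IR.ShellTempered (windowCellsPlus)

section Instantiate

variable {G : Type} [MeasurableSpace G] (γ : Specification (ZdEdge 4) G)
  {w : Fin 4 → ℤ → ℤ} (hw : ∀ i j, w i j + 1 ≤ w i (j + 1))
  {n : ℕ} {ε δ : ℝ}
  (GoodW : (Fin 4 → ℤ) → (Fin 4 → ℤ) → Set (ZdEdge 4 → G))

include hw in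
/-- Per-cell rarity in the shifted frames ⇒ hypothesis `hBad` of the tempered recursion for the
family `Good x c := GoodW x (c - x)`. -/
theorem hBad_of_rare
    (hrare : ∀ (x c : Fin 4 → ℤ) (E' : Finset (ZdEdge 4)), cellEdges (shiftFrame w x) c ⊆ E' →
      ∀ ζ : ZdEdge 4 → G, (γ E' ζ) (GoodW x c)ᶜ ≤ ENNReal.ofReal δ)
    (x c : Fin 4 → ℤ) (E : Finset (ZdEdge 4)) (hE : ∀ v, frameCell w v = c → v ∈ E)
    (ζ : ZdEdge 4 → G) : (γ E ζ) (GoodW x (c - x))ᶜ ≤ ENNReal.ofReal δ := by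
  refine hrare x (c - x) E (fun e he => hE e ?_) ζ
  rw [cellEdges_shiftFrame, sub_add_cancel] at he
  exact (frameCell_eq_iff hw e c).2 he

include hw in
/-- Sub-region mixing for tempered pairs in the shifted frames ⇒ hypothesis `hFS` of the tempered
recursion (the analogue of `Theorems.FiniteSizeCriterion.gridFS_of_frameFS`). -/
theorem hFS_of_mix
    (hmix : ∀ x : Fin 4 → ℤ, ∀ Y : Finset (Fin 4 → ℤ), Y ⊆ windowCells n → (0 : Fin 4 → ℤ) ∈ Y →
      ∀ σ σ' : ZdEdge 4 → G,
        (∀ c ∈ windowCellsPlus n, c ∉ Y →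
          ((∀ e ∈ cellEdges (shiftFrame w x) c, σ e = σ' e) ∨ (σ ∈ GoodW x c ∧ σ' ∈ GoodW x c))) →
        ∀ f : (ZdEdge 4 → G) → ℝ, IsCylinder f (cellEdges (shiftFrame w x) 0) → Measurable f →
          (∀ U, 0 ≤ f U ∧ f U ≤ 1) →
          |(∫ U, f U ∂(γ (regionEdges (shiftFrame w x) Y) σ)) -
            ∫ U, f U ∂(γ (regionEdges (shiftFrame w x) Y) σ')| ≤ ε)
    (x : Fin 4 → ℤ) (Λ₀ : Finset (ZdEdge 4))
    (hunion : ∀ v v', frameCell w v = frameCell w v' → v ∈ Λ₀ → v' ∈ Λ₀)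
    (hnear : ∀ v ∈ Λ₀, ∀ i, |frameCell w v i - x i| ≤ 2 * n)
    (hx : ∀ v, frameCell w v = x → v ∈ Λ₀) (η η' : ZdEdge 4 → G)
    (hT : ∀ v, v ∉ Λ₀ → (∀ i, |frameCell w v i - x i| ≤ 2 * n + 1) →
      (η v = η' v ∨ (η ∈ GoodW x (frameCell w v - x) ∧ η' ∈ GoodW x (frameCell w v - x))))
    (f : (ZdEdge 4 → G) → ℝ) (hfdep : DependsOn f {v | frameCell w v = x}) (hfm : Measurable f)
    (hf01 : ∀ σ, 0 ≤ f σ ∧ f σ ≤ 1) :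
    |∫ σ, f σ ∂(γ Λ₀ η) - ∫ σ, f σ ∂(γ Λ₀ η')| ≤ ε := by
  classical
  -- the cells of the shifted frame are the cells of `w`, re-indexed
  have hmem : ∀ (y : Fin 4 → ℤ) (e : ZdEdge 4),
      e ∈ cellEdges (shiftFrame w x) y ↔ frameCell w e = y + x := by
    intro y e
    rw [cellEdges_shiftFrame, frameCell_eq_iff hw]
  -- the cells met by `Λ₀`, recentred
  set Y : Finset (Fin 4 → ℤ) := Λ₀.image fun v => frameCell w v - x with hY
  have hYsub : Y ⊆ windowCells n := by
    intro y hy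
    obtain ⟨v, hv, rfl⟩ := Finset.mem_image.1 hy
    simp only [Summit.QuantumFields.YangMills.Cruxes.IR.Tempered.windowCells, Fintype.mem_piFinset,
      Finset.mem_Icc, Pi.sub_apply]
    intro i
    have h := abs_le.1 (hnear v hv i)
    exact ⟨h.1, h.2⟩
  have hcx : frameCell w ((fun i => w i (x i)), (0 : Fin 4)) = x := by
    rw [frameCell_eq_iff hw]
    simp only [Summit.QuantumFields.YangMills.Cruxes.IR.Tempered.cellEdges, Finset.mem_product,
      Finset.mem_univ, and_true, Fintype.mem_piFinset, Finset.mem_Ico]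
    intro i
    exact ⟨le_rfl, by linarith [hw i (x i)]⟩
  have h0Y : (0 : Fin 4 → ℤ) ∈ Y :=
    Finset.mem_image.2 ⟨_, hx _ hcx, by rw [hcx, sub_self]⟩
  have hbiU : regionEdges (shiftFrame w x) Y = Λ₀ := by
    ext e
    simp only [Summit.QuantumFields.YangMills.Cruxes.IR.Tempered.regionEdges, Finset.mem_biUnion]
    constructor
    · rintro ⟨y, hy, he⟩
      obtain ⟨v, hv, rfl⟩ := Finset.mem_image.1 hy
      rw [hmem, sub_add_cancel] at he
      exact hunion v e he.symm hv
    · intro he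
      refine ⟨frameCell w e - x, Finset.mem_image.2 ⟨e, he, rfl⟩, ?_⟩
      rw [hmem, sub_add_cancel]
  -- the pair condition on the cells of window+shell off `Y`
  have hpair : ∀ c ∈ windowCellsPlus n, c ∉ Y →
      ((∀ e ∈ cellEdges (shiftFrame w x) c, η e = η' e) ∨ (η ∈ GoodW x c ∧ η' ∈ GoodW x c)) := by
    intro c hc hcY
    by_cases hall : ∀ e ∈ cellEdges (shiftFrame w x) c, η e = η' e
    · exact Or.inl hall
    · push Not at hall
      obtain ⟨e, he, hne⟩ := hall
      rw [hmem] at he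
      have heΛ : e ∉ Λ₀ := fun h =>
        hcY (Finset.mem_image.2 ⟨e, h, by rw [he, add_sub_cancel_right]⟩)
      have hnear' : ∀ i, |frameCell w e i - x i| ≤ 2 * n + 1 := by
        intro i
        have hci := Finset.mem_Icc.1 (Fintype.mem_piFinset.1 hc i)
        rw [he, Pi.add_apply, add_sub_cancel_right, abs_le]
        exact ⟨by linarith [hci.1], hci.2⟩
      rcases hT e heΛ hnear' with h | h
      · exact absurd h hne
      · rw [he, add_sub_cancel_right] at h
        exact Or.inr h
  have hcyl : IsCylinder f (cellEdges (shiftFrame w x) 0) := by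
    intro σ σ' h
    refine hfdep fun v hv => h v ?_
    rw [Finset.mem_coe, hmem, zero_add]
    exact hv
  have key := hmix x Y hYsub h0Y η η' hpair f hcyl hfm hf01
  rwa [hbiU] at key

end Instantiate

end Summit.QuantumFields.YangMills.Cruxes.IR.CellTempered.Engine

end
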